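import Mathlib
import Summits.MatrixMultiplication.MatrixMultiplication.Theorems.SoloInformedValTriforce

/-!
# SoloInformedValTriforceAnswer — `Val(△, N) ≥ N^{2-ε}`: triforce-freeness carries no power saving

Pratt [arXiv:2309.03878 (ITCS 2024, LIPIcs 287:89), Def. 4.10, Prop. 4.11, Prop. 4.13]: `Val(n) ≤ Val(△, n) ≤ o(n²)`,
where `Val(△, n)` is the maximum number of solutions of `a + b + c = n` over triforce-free `A, B, C ⊆ {0,…,n}`
("a first relaxation that still seems very stringent … for which we know basically nothing").

`val_triforce_lower_bound` : for every `ε > 0` and all sufficiently large `N` there are triforce-free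
`A, B, C ⊆ {0,…,N}` with at least `N^{2-ε}` solutions of `a + b + c = N`.  Hence `Val(△, N) = N^{2-o(1)}`, while
`Val(N) ≤ N^{3/2}` (the first averaged trapezoid condition and Cauchy–Schwarz, file `SoloInformedValAveragedAnswer`):
Proposition 4.11 is off by a power `≥ 1/2`, and every power saving in an upper bound for `Val` has to come from the
equilateral-trapezoid (4-cycle) conditions — by `pratt_question_4_9`, from their pointwise form.

The sets are those of `SoloInformedValTriforce` (Beker's bi-skew sphere set, arXiv:2402.19169 §2, read as a
cylindrical corner-free set) with `d = ⌈12/ε⌉₊ + 4` digits, base `M = ⌊(N/2)^{1/d}⌋₊`, `m = ⌊(M+1)/2⌋`, and `C`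
translated so that the target becomes `N`.  This file: the translation lemmas `TriforceFree.shiftC`,
`card_solutions_shiftC`, the integer size bound `size_bound`, the real-number bookkeeping `asymptotic_core`
(stated once, reusable for other configurations of the same size), and the headline.  Standard axioms only.
-/

namespace Summit.MatrixMultiplication.MatrixMultiplication.Theorems.SoloVal

open Finset

/-! ### Translating `C` and the target -/

/-- Triforce-freeness is invariant under translating `C` and the target together. -/
theorem TriforceFree.shiftC {A B C : Finset ℤ} {t : ℤ} (h : TriforceFree A B C t) (s : ℤ) :
    TriforceFree A B (C.image (· + s)) (t + s) := by
  intro a ha a' ha' b hb b' hb' c hc c' hc' h1 h2 h3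
  simp only [mem_image] at hc hc'
  obtain ⟨c₀, hc₀, rfl⟩ := hc
  obtain ⟨c₀', hc₀', rfl⟩ := hc'
  rcases h a ha a' ha' b hb b' hb' c₀ hc₀ c₀' hc₀' (by linarith) (by linarith) (by linarith) with h | h | h
  · exact Or.inl h
  · exact Or.inr (Or.inl h)
  · exact Or.inr (Or.inr (by rw [h]))

/-- The number of solutions does not decrease under the translation. -/
theorem card_solutions_shiftC (A B C : Finset ℤ) (t s : ℤ) :
    #(solutions A B C t) ≤ #(solutions A B (C.image (· + s)) (t + s)) := by
  refine card_le_card_of_injOn (fun p => (p.1, p.2.1, p.2.2 + s)) ?_ ?_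
  · intro p hp
    have hp' : p ∈ solutions A B C t := hp
    simp only [solutions, mem_filter, mem_product] at hp'
    have hmem : (p.1, p.2.1, p.2.2 + s) ∈ solutions A B (C.image (· + s)) (t + s) := by
      simp only [solutions, mem_filter, mem_product]
      exact ⟨⟨hp'.1.1, hp'.1.2.1, mem_image_of_mem _ hp'.1.2.2⟩, by linarith [hp'.2]⟩
    exact hmem
  · intro p _ q _ hpq
    simp only [Prod.mk.injEq] at hpq
    obtain ⟨e1, e2, e3⟩ := hpq
    exact Prod.ext e1 (Prod.ext e2 (by linarith))

/-! ### The integer size bound -/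

/-- For `d ≥ 4` digits and `m ≥ 2d² + 1` the construction has `r, t` with `m^{2d} ≤ 4 (d m²)^3 · #solutions`. -/
theorem size_bound (d m M : ℕ) (hd : 4 ≤ d) (hm : 2 * d ^ 2 + 1 ≤ m) (hmM : 2 * m ≤ M + 1) : ∃ r t : ℕ,
    TriforceFree (setA d m M r) (setA d m M r) (setC d M r t) (tgt d M) ∧
    (m ^ d) ^ 2 ≤ 4 * (d * m ^ 2) ^ 3 * #(solutions (setA d m M r) (setA d m M r) (setC d M r t) (tgt d M)) := by
  have hm1 : 1 ≤ m := by nlinarith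
  obtain ⟨r, t, hfree, hcount⟩ := config_summary d m M hm1 hmM
  refine ⟨r, t, hfree, ?_⟩
  set K := d * (m - 1) ^ 2 + 1 with hK
  have hKpos : 0 < K := by positivity
  have hKle : K ≤ d * m ^ 2 := by
    have h1 : (m - 1) ^ 2 + 1 ≤ m ^ 2 := by
      have : 1 ≤ m := hm1
      zify [this]
      nlinarith
    calc K = d * (m - 1) ^ 2 + 1 := hK
      _ ≤ d * ((m - 1) ^ 2 + 1) := by nlinarith
      _ ≤ d * m ^ 2 := Nat.mul_le_mul_left _ h1
  have hbig : 4 * K ^ 3 ≤ (m ^ d) ^ 2 := by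
    have h1 : 4 * d ^ 3 ≤ m ^ 2 := by nlinarith
    calc 4 * K ^ 3 ≤ 4 * (d * m ^ 2) ^ 3 := by gcongr
      _ = (4 * d ^ 3) * m ^ 6 := by ring
      _ ≤ m ^ 2 * m ^ 6 := Nat.mul_le_mul_right _ h1
      _ = m ^ 8 := by ring
      _ ≤ m ^ (2 * d) := Nat.pow_le_pow_right hm1 (by omega)
      _ = (m ^ d) ^ 2 := by ring
  have h := arith_bound hKpos hcount hbig
  calc (m ^ d) ^ 2 ≤ 4 * K ^ 3 * _ := h
    _ ≤ 4 * (d * m ^ 2) ^ 3 * _ := by gcongr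

/-! ### The asymptotic statement -/

/-- Parameter facts: with `ρ = (N/2)^{1/d} ≥ 4d²+3`, `M = ⌊ρ⌋₊`, `m = ⌊(M+1)/2⌋`:
`2d²+1 ≤ m`, `2m ≤ M+1`, `m ≤ M`, `ρ/4 ≤ m ≤ ρ` and `2 M^d ≤ N`. -/
theorem param_facts {N d : ℕ} (hd : 1 ≤ d) {ρ : ℝ} (hρ : ρ = ((N : ℝ) / 2) ^ ((d : ℝ)⁻¹))
    (hρd : (4 * (d : ℝ) ^ 2 + 3) ≤ ρ) :
    2 * d ^ 2 + 1 ≤ (⌊ρ⌋₊ + 1) / 2 ∧ 2 * ((⌊ρ⌋₊ + 1) / 2) ≤ ⌊ρ⌋₊ + 1 ∧ (⌊ρ⌋₊ + 1) / 2 ≤ ⌊ρ⌋₊ ∧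
      ρ / 4 ≤ (((⌊ρ⌋₊ + 1) / 2 : ℕ) : ℝ) ∧ (((⌊ρ⌋₊ + 1) / 2 : ℕ) : ℝ) ≤ ρ ∧ 2 * ⌊ρ⌋₊ ^ d ≤ N := by
  set M := ⌊ρ⌋₊ with hM
  have hρ0 : 0 ≤ ρ := le_trans (by positivity) hρd
  have hMle : (M : ℝ) ≤ ρ := Nat.floor_le hρ0
  have hMgt : ρ < M + 1 := Nat.lt_floor_add_one ρ
  have hMd : 4 * d ^ 2 + 2 ≤ M := by
    have : (4 * d ^ 2 + 2 : ℝ) < M := by linarith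
    exact_mod_cast this.le
  refine ⟨by omega, by omega, by omega, ?_, ?_, ?_⟩
  · have h2 : (M : ℝ) ≤ 2 * (((M + 1) / 2 : ℕ) : ℝ) := by
      exact_mod_cast (show M ≤ 2 * ((M + 1) / 2) by omega)
    have hd2 : (0 : ℝ) ≤ (d : ℝ) ^ 2 := sq_nonneg _
    linarith
  · have : (((M + 1) / 2 : ℕ) : ℝ) ≤ M := by exact_mod_cast (show (M + 1) / 2 ≤ M by omega)
    linarith
  · have hx0 : (0 : ℝ) ≤ (N : ℝ) / 2 := by positivity
    have hpow : (M : ℝ) ^ d ≤ (N : ℝ) / 2 := by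
      calc (M : ℝ) ^ d ≤ ρ ^ d := by gcongr
        _ = (N : ℝ) / 2 := by rw [hρ]; exact Real.rpow_inv_natCast_pow hx0 (by omega)
    have : ((2 * M ^ d : ℕ) : ℝ) ≤ N := by push_cast; linarith
    exact_mod_cast this

/-- **Exponent bookkeeping** (shared with the sequel on skew corners).  For every `ε > 0` there are a
number of digits `d ≥ 4` and a threshold `N₀` such that every `N ≥ N₀` admits a base `M` and a box size `m` with
`2d²+1 ≤ m`, `2m ≤ M+1`, `m ≤ M`, `2M^d ≤ N`, and such that any quantity `L` with `m^{2d} ≤ 4 (d m²)^3 L` satisfies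
`N^{2-ε} ≤ L`.  (`d = ⌈12/ε⌉₊ + 4`, `M = ⌊(N/2)^{1/d}⌋₊`, `m = ⌊(M+1)/2⌋`.) -/
theorem asymptotic_core (ε : ℝ) (hε : 0 < ε) : ∃ d N₀ : ℕ, 4 ≤ d ∧ ∀ N : ℕ, N₀ ≤ N →
    ∃ M m : ℕ, 2 * d ^ 2 + 1 ≤ m ∧ 2 * m ≤ M + 1 ∧ m ≤ M ∧ 2 * M ^ d ≤ N ∧
      ∀ L : ℕ, (m ^ d) ^ 2 ≤ 4 * (d * m ^ 2) ^ 3 * L → (N : ℝ) ^ (2 - ε) ≤ L := by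
  -- the number of digits
  set d : ℕ := ⌈12 / ε⌉₊ + 4 with hd
  have hd4 : 4 ≤ d := by omega
  have hd1 : 1 ≤ d := by omega
  have hdpos : (0 : ℝ) < d := by exact_mod_cast (show 0 < d by omega)
  have hdε : 12 / ε ≤ d := by
    have : (⌈12 / ε⌉₊ : ℝ) ≤ d := by rw [hd]; push_cast; linarith
    exact le_trans (Nat.le_ceil _) this
  -- the constant
  set c : ℝ := (16 : ℝ) ^ (d + 1) * (d : ℝ) ^ 3 with hc
  have hcpos : 0 < c := by positivity
  refine ⟨d, max (2 * (4 * d ^ 2 + 3) ^ d) ⌈c ^ (2 / ε)⌉₊, hd4, fun N hN => ?_⟩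
  have hN1 : 2 * (4 * d ^ 2 + 3) ^ d ≤ N := le_trans (le_max_left _ _) hN
  have hN2 : c ^ (2 / ε) ≤ N := le_trans (Nat.le_ceil _) (by exact_mod_cast le_trans (le_max_right _ _) hN)
  have hNone : 1 ≤ N := by
    have := Nat.one_le_pow d (4 * d ^ 2 + 3) (by omega)
    omega
  have hNpos : (0 : ℝ) < N := by exact_mod_cast hNone
  have hN1' : (1 : ℝ) ≤ N := by exact_mod_cast hNone
  -- ρ and the parameters
  set x : ℝ := (N : ℝ) / 2 with hx
  have hx0 : 0 ≤ x := by positivity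
  set ρ : ℝ := x ^ ((d : ℝ)⁻¹) with hρ
  have hρd : (4 * (d : ℝ) ^ 2 + 3) ≤ ρ := by
    have h1 : ((4 * (d : ℝ) ^ 2 + 3) ^ d) ≤ x := by
      have : (((4 * d ^ 2 + 3) ^ d : ℕ) : ℝ) ≤ x := by
        rw [hx, le_div_iff₀ (by norm_num)]
        exact_mod_cast (show (4 * d ^ 2 + 3) ^ d * 2 ≤ N by omega)
      exact_mod_cast this
    have h2 := Real.rpow_le_rpow (by positivity) h1 (by positivity : (0 : ℝ) ≤ (d : ℝ)⁻¹)
    rwa [Real.pow_rpow_inv_natCast (by positivity) (by omega)] at h2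
  have hρ2 : 2 ≤ ρ := le_trans (by nlinarith) hρd
  have hρpos : 0 < ρ := by linarith
  obtain ⟨hm, hmM, hmM', hmlo, hmhi, hMN⟩ := param_facts (N := N) hd1 hρ hρd
  set M := ⌊ρ⌋₊ with hM
  set m := (M + 1) / 2 with hm_def
  refine ⟨M, m, hm, hmM, hmM', hMN, fun L hsize => ?_⟩
  have hsizeR : ((m : ℝ) ^ d) ^ 2 ≤ 4 * ((d : ℝ) * (m : ℝ) ^ 2) ^ 3 * L := by exact_mod_cast hsize
  have hm0 : (0 : ℝ) ≤ m := by positivity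
  -- lower and upper bounds for m in terms of ρ
  have hρ4 : 0 ≤ ρ / 4 := by positivity
  have hlow : (ρ / 4) ^ (2 * d) ≤ (m : ℝ) ^ (2 * d) := by gcongr
  have hup : (m : ℝ) ^ 6 ≤ ρ ^ 6 := by gcongr
  have hρdx : ρ ^ d = x := by rw [hρ]; exact Real.rpow_inv_natCast_pow hx0 (by omega)
  have hlow' : (ρ / 4) ^ (2 * d) = x ^ 2 / 16 ^ d := by
    rw [div_pow, pow_mul', hρdx, pow_mul]
    norm_num
  -- main real inequality: x² / 16^d ≤ 4 d³ ρ⁶ L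
  have hmain : x ^ 2 / 16 ^ d ≤ 4 * (d : ℝ) ^ 3 * ρ ^ 6 * L := by
    have hL0 : (0 : ℝ) ≤ L := by positivity
    calc x ^ 2 / 16 ^ d = (ρ / 4) ^ (2 * d) := hlow'.symm
      _ ≤ (m : ℝ) ^ (2 * d) := hlow
      _ = ((m : ℝ) ^ d) ^ 2 := by ring
      _ ≤ 4 * ((d : ℝ) * (m : ℝ) ^ 2) ^ 3 * L := hsizeR
      _ = 4 * (d : ℝ) ^ 3 * (m : ℝ) ^ 6 * L := by ring
      _ ≤ 4 * (d : ℝ) ^ 3 * ρ ^ 6 * L := by gcongr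
  -- ρ⁶ ≤ N^{6/d} ≤ N^{ε/2} and c ≤ N^{ε/2}
  have hρ6 : ρ ^ 6 ≤ (N : ℝ) ^ (ε / 2) := by
    have h1 : ρ ≤ (N : ℝ) ^ ((d : ℝ)⁻¹) :=
      Real.rpow_le_rpow hx0 (by rw [hx]; linarith) (by positivity)
    have h2 : ρ ^ 6 ≤ ((N : ℝ) ^ ((d : ℝ)⁻¹)) ^ 6 := by gcongr
    have h3 : ((N : ℝ) ^ ((d : ℝ)⁻¹)) ^ 6 = (N : ℝ) ^ ((d : ℝ)⁻¹ * 6) := by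
      rw [← Real.rpow_mul_natCast hNpos.le]; norm_num
    have h4 : (d : ℝ)⁻¹ * 6 ≤ ε / 2 := by
      rw [inv_mul_le_iff₀ hdpos]
      have := (div_le_iff₀ hε).1 hdε
      linarith
    calc ρ ^ 6 ≤ ((N : ℝ) ^ ((d : ℝ)⁻¹)) ^ 6 := h2
      _ = (N : ℝ) ^ ((d : ℝ)⁻¹ * 6) := h3
      _ ≤ (N : ℝ) ^ (ε / 2) := Real.rpow_le_rpow_of_exponent_le hN1' h4
  have hcN : c ≤ (N : ℝ) ^ (ε / 2) := by
    have := Real.rpow_le_rpow (by positivity) hN2 (by positivity : (0 : ℝ) ≤ ε / 2)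
    rwa [← Real.rpow_mul hcpos.le, show (2 / ε) * (ε / 2) = (1 : ℝ) by field_simp, Real.rpow_one] at this
  have hε' : c * ρ ^ 6 ≤ (N : ℝ) ^ ε := by
    calc c * ρ ^ 6 ≤ (N : ℝ) ^ (ε / 2) * (N : ℝ) ^ (ε / 2) :=
          mul_le_mul hcN hρ6 (by positivity) (by positivity)
      _ = (N : ℝ) ^ ε := by rw [← Real.rpow_add hNpos]; ring_nf
  -- conclude
  have hsplit : (N : ℝ) ^ (2 - ε) = (N : ℝ) ^ 2 / (N : ℝ) ^ ε := by
    rw [Real.rpow_sub hNpos, Real.rpow_two]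
  rw [hsplit]
  have hcρ : 0 < c * ρ ^ 6 := by positivity
  calc (N : ℝ) ^ 2 / (N : ℝ) ^ ε ≤ (N : ℝ) ^ 2 / (c * ρ ^ 6) :=
        div_le_div_of_nonneg_left (by positivity) hcρ hε'
    _ = (x ^ 2 / 16 ^ d) / (4 * (d : ℝ) ^ 3 * ρ ^ 6) := by
        rw [hx, hc]; field_simp; ring
    _ ≤ L := by
        rw [div_le_iff₀ (by positivity)]
        linarith [hmain]

/-- **`Val(△, N) ≥ N^{2-ε}` [answer to the "we know basically nothing" after Pratt's Prop. 4.11].**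
For every `ε > 0` and all sufficiently large `N` there are triforce-free `A, B, C ⊆ {0,…,N}` (Def. 4.10)
with at least `N^{2-ε}` solutions of `a + b + c = N`. -/
theorem val_triforce_lower_bound (ε : ℝ) (hε : 0 < ε) :
    ∃ N₀ : ℕ, ∀ N : ℕ, N₀ ≤ N → ∃ A B C : Finset ℤ,
      A ⊆ Icc (0 : ℤ) N ∧ B ⊆ Icc (0 : ℤ) N ∧ C ⊆ Icc (0 : ℤ) N ∧ TriforceFree A B C N ∧
      (N : ℝ) ^ (2 - ε) ≤ #(solutions A B C N) := by
  obtain ⟨d, N₀, hd4, hcore⟩ := asymptotic_core ε hε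
  refine ⟨N₀, fun N hN => ?_⟩
  obtain ⟨M, m, hm, hmM, hmM', hMN, hL⟩ := hcore N hN
  -- the configuration
  obtain ⟨r, t, hfree, hsize⟩ := size_bound d m M hd4 hm hmM
  set A := setA d m M r with hA
  set C := setC d M r t with hC
  set s : ℤ := (N : ℤ) - (tgt d M : ℤ) with hs
  have hMN' : ((M : ℤ)) ^ d ≤ N := by
    have : ((M ^ d : ℕ) : ℤ) ≤ N := by exact_mod_cast (by omega : M ^ d ≤ N)
    exact_mod_cast this
  refine ⟨A, A, C.image (· + s), ?_, ?_, ?_, ?_, ?_⟩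
  · intro a ha
    obtain ⟨h0, h1⟩ := setA_bounds d m M r hmM' ha
    rw [mem_Icc]; constructor <;> linarith
  · intro a ha
    obtain ⟨h0, h1⟩ := setA_bounds d m M r hmM' ha
    rw [mem_Icc]; constructor <;> linarith
  · intro c' hc'
    rw [mem_image] at hc'
    obtain ⟨c₀, hc₀, rfl⟩ := hc'
    obtain ⟨h0, h1⟩ := setC_bounds d M r t hc₀
    have htgt : (tgt d M : ℤ) = 2 * (M : ℤ) ^ d := by simp [tgt]
    rw [mem_Icc, hs, htgt]
    constructor
    · linarith
    · linarith
  · have h := hfree.shiftC s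
    have : (tgt d M : ℤ) + s = N := by rw [hs]; ring
    rwa [this] at h
  · -- the count
    have hle := card_solutions_shiftC A A C (tgt d M) s
    have htarget : (tgt d M : ℤ) + s = N := by rw [hs]; ring
    rw [htarget] at hle
    exact hL _ (le_trans hsize (by gcongr))

end Summit.MatrixMultiplication.MatrixMultiplication.Theorems.SoloVal
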